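import Literature.NumberTheory.EllipticCurves.KrizLi2019.TwoPartBSDTwists
import Literature.NumberTheory.EllipticCurves.Zhai2021.TwoAdicLowerBoundTwists
import Literature.NumberTheory.EllipticCurves.X1ElevenFiveIsogeny
import HarnessLib

/-!
# Kriz–Li 2019 (FMS 7, e15), §6 Table 2 («Assumption (★) for rank zero curves») — the rows `11a1`, `37b1`, `67a1` AS PRINTED: for the optimal
# curves `E ∈ {11a1, 37b1, 67a1}` and `K = ℚ(√−7)`, Assumption (★) holds (statement-only named facts; the per-curve inputs of Thm 5.1 (2) =
# `thm112_bsdTwo_twist` at the three rank-ZERO rows of the table that are GOOD at `2` with `c₂(E) = 1` and `49·N < 5000`)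

HONEST FRAMING (cell `bsd-f1-sign2`, seat `bsd-line-gk2-p2` g35, crux U₂ `MinimalTwinBSDTwo` stmt-BirchSwinnertonDyer-22985, LINE 23 «twin_swap»;
2026-08-31): three PUBLISHED per-curve computational assertions (check-marks in a table of a refereed paper) vendored as named `Prop`s — nothing
asserted, nothing discharged (D-0014) — with a locator into the held source; companions of `KrizLi2019.table2_row44a1/92a1` (`Table2RankZeroRows.lean`,
seat `bsd-2adic-k4-w2`: the two ADDITIVE-at-`2` rows of Table 2 with `49·N < 5000`) in the SAME shape (optimal parametrisation datum transcribed because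
Example 6.5 searches «rank zero OPTIMAL elliptic curves»; all three curves are GOOD at `2`, so consumers of Thm 5.1 (2) may ignore the optimality
conjunct).  Why U₂ (BSD₂ in analytic rank ONE) wants rank-ZERO rows: for a rank-zero anchor `E` the companion `E^{(−7)}` and the packet members
`E^{(−7d)}` (`d ∈ 𝒩(E, K)`, `χ_d(−N) = 1`) have analytic rank ONE (Thm 4.3), and for these three rows BOTH numerical `BSD(2)` inputs of Thm 5.1 (2)
(`N` and `49·N = 539, 1813, 3283 < 5000`) lie in Creutz–Miller's range — so `BSD₂` on the rank-one half of the packet follows from PRINT ALONE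
(consumer: `Summits/…/Theorems/GenusKolyvaginAtTwoMinimalTwinBSDTwoKrizLiAnchor11a1.lean` and its `37b1`/`67a1` companions, this seat).  Everything
else about the rows (`E(ℚ)[2] = 0`, good reduction at `2` with `c₂ = 1`, the Heegner hypothesis, `N`, the companion's conductor) is decided IN THE
KERNEL by the consumer; `r_an(11a1) = 0` is the tree's `Curve11a.analyticRank_eq_zero_of_modularity`.  Nothing is booked here; BSD is not proved by
any of this.

Source. D. Kriz, C. Li, *Goldfeld's conjecture and congruences between Heegner points*, Forum Math. Sigma **7** (2019), e15, doi:10.1017/fms.2019.9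
[KrizLi2019] = arXiv:1606.03172 (§§1–6). Texts read: the held chunk text `paper:doi-10-1017-fms-2019-9` (p0018 L17: Examples 6.4–6.5), which DROPS
the table body; the table itself was read in the arXiv v3 source `Congruence.tex` (copy at
`run/shared/lean/pub/bsd-print-cf2/lit/krizli2019/arXiv-1606.03172v3-Congruence.tex`), ll. 1036–1084 (`\label{tab:2}`, Example 6.5), rows at lines
1043 (`11a1 & -7 & 1 & \checkmark`), 1044 (`37b1 & -7 & 1 & \checkmark`) and 1046 (`67a1 & -7 & 1 & \checkmark`).

## The printed statement (verbatim)

* Example 6.5 (tex l. 1037): "For rank zero curves, the computation of Heegner points is most feasible when `|d_K|` is small. Thus we fix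
  `d_K = −7` and search for rank zero optimal curves with `E(ℚ)[2] = 0` satisfying the two necessary conditions in Example 6.2 and such that
  `K = ℚ(√−7)` satisfies the Heegner hypothesis. There are 39 such curves of conductor `≤ 750`. See Table 2. Then 28 out of 39 curves satisfy (★),
  in which case Theorems 4.3, 1.12 apply and the improved bound towards Goldfeld's conjecture holds. If `c₂(E)` is further odd (true for 24 out
  of 28), then the application to BSD(2) (Theorem 5.1) also applies."
* Table 2, caption "Assumption (★) for rank zero curves", header `E | d_K | c₂(E) | ★`, first rows: "**`11a1 & -7 & 1 & ✓`**",
  "**`37b1 & -7 & 1 & ✓`**", "`44a1 & -7 & 3 & ✓`", "**`67a1 & -7 & 1 & ✓`**", "`92a1 & -7 & 3 & ✓`", "`116a1 & -7 & 3 &`", ….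
* Example 6.4 (`E = 11a1`): "Consider the curve `E = 11a1 = X₀(11)` … (★) holds … Since BSD(2) is true for `E/ℚ` and `E^{(−7)}/ℚ` by numerical
  verification, it follows from Theorem 5.1 that the BSD(2) is true for `E^{(d)}` and `E^{(−7d)}`" (FMS chunk p0018 L17).

## Transcription (tree dictionary of `KrizLi2019/TwoPartBSDTwists.lean`)

`E = 11a1` = the tree's `X1Eleven.curve11A1 = [0, −1, 1, −10, −20]` (`y² + y = x³ − x² − 10x − 20`, `Δ = −11⁵`, `N = 11`); `E = 37b1` = Cremona's
globally minimal model `[0, 1, 1, −23, −50]` (`y² + y = x³ + x² − 23x − 50`, `Δ = 37³`, `N = 37`); `E = 67a1` = `[0, 1, 1, −12, −21]`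
(`y² + y = x³ + x² − 12x − 21`, `Δ = −67`, `N = 67`) — the models of the tree's kit census `HypothesisSweep/RecordsN000011to000115.lean` (rows
`37b1`, `67a1`; `11a1` = `Schema.swept_sample`).  "`K = ℚ(√−7)`" = any `K` with `IsImaginaryQuadratic K` and `NumberField.discr K = −7`.
"Optimal curve with its parametrisation" = a datum `Dt : ModularParametrizationData E N` at the conductor level (`NeZero` witness packed) with
`Zhai2021.IsOptimalDatum E Dt`; "(★) holds" = a Heegner datum `H`, an embedding `ι`, a point `P ∈ E(K)` mapping to `heegnerPointComplex Dt H`, and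
`j : K →ₐ[ℚ] ℚ₂` with `AssumptionStar E Dt K P j` — exactly the binders of `thm112_bsdTwo_twist` / `thm33_rank_twist`.  Global minimality of the
printed model is a binder `[IsGloballyMinimal]`.  "Rank zero", "`E(ℚ)[2] = 0`", "`c₂(E) = 1`" are NOT transcribed (kernel-side / tree-side in the
consumer).  Nothing weaker or stronger is transcribed; no `_holds` is expected (a `2`-adic logarithm of an explicit Heegner point).  Status: PUB
(refereed); per-curve computational TABLE entries, flag word for the referee: TABLE.

## References
* [KrizLi2019] §6 Examples 6.4–6.5 and Table 2 (rows 11a1, 37b1, 67a1) (FMS chunk p0018 L17; arXiv:1606.03172v3 `Congruence.tex` ll. 1037,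
  1043, 1044, 1046); Assumption (★) (arXiv p0003 L45–L48); Thm 5.1 (2) = arXiv Thm 1.12.
* [CremonaAlgorithms1997] Table 1 (curves 11A1 = `[0,−1,1,−10,−20]`, 37B1 = `[0,1,1,−23,−50]`, 67A1 = `[0,1,1,−12,−21]`; `r = 0`).
* [Zhai2021BSDExactFormulaTwists] §1 (the optimality predicate `IsOptimalDatum`).
-/

noncomputable section

open scoped Classical

open NumberField WeierstrassCurve Literature.NumberTheory.EllipticCurves
  Literature.NumberTheory.EllipticCurves.ModularForms

namespace Literature.NumberTheory.EllipticCurves.KrizLi2019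

/-- **Kriz–Li 2019, §6 Table 2, row `11a1`** (verbatim in the module docstring: `11a1 | d_K = −7 | c₂(E) = 1 | ★ ✓`; Examples 6.4–6.5 "rank zero
optimal curves … `K = ℚ(√−7)`"): for every imaginary quadratic field `K` of discriminant `−7`, the optimal curve `11a1 = X₀(11)` on its (globally minimal)
model `X1Eleven.curve11A1 = [0,−1,1,−10,−20]` admits an OPTIMAL modular parametrisation datum `Dt` at level `N(E)` (`Zhai2021.IsOptimalDatum`), a Heegner
datum `H` of discriminant `d_K` and level `N(E)`, an embedding `ι : K → ℂ`, a point `P ∈ E(K)` mapping to `heegnerPointComplex Dt H`, and `j : K → ℚ₂` with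
Assumption (★) `AssumptionStar E Dt K P j` — the hypotheses of `thm112_bsdTwo_twist` at `W = curve11A1`.  Statement only; TABLE entry; no `_holds` expected.
[cite: KrizLi2019, §6 Table 2 (row 11a1), Example 6.4 and Example 6.5 (FMS 7 (2019) e15, chunk p0018 L17; arXiv:1606.03172v3 Congruence.tex ll. 1037, 1043)] -/
def table2_row11a1 : Prop :=
  ∀ [X1Eleven.curve11A1.IsGloballyMinimal]
    (K : Type) [Field K] [NumberField K], IsImaginaryQuadratic K → NumberField.discr K = -7 →
    ∃ (_ : NeZero (X1Eleven.curve11A1.conductorNorm ℤ))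
      (Dt : ModularParametrizationData X1Eleven.curve11A1 (X1Eleven.curve11A1.conductorNorm ℤ))
      (H : HeegnerDatum (X1Eleven.curve11A1.conductorNorm ℤ) (NumberField.discr K))
      (ι : K →+* ℂ) (P : (X1Eleven.curve11A1.baseChange K).toAffine.Point) (j : K →ₐ[ℚ] ℚ_[2]),
      Zhai2021.IsOptimalDatum X1Eleven.curve11A1 Dt ∧
        WeierstrassCurve.Affine.Point.map ι.toRatAlgHom P = heegnerPointComplex Dt H ∧
          AssumptionStar X1Eleven.curve11A1 Dt K P j

/-- **Kriz–Li 2019, §6 Table 2, row `37b1`** (verbatim in the module docstring: `37b1 | d_K = −7 | c₂(E) = 1 | ★ ✓`; Example 6.5): for every imaginary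
quadratic field `K` of discriminant `−7`, the optimal curve `37b1` on its (globally minimal) model `[0,1,1,−23,−50]` (`y² + y = x³ + x² − 23x − 50`) admits
an OPTIMAL modular parametrisation datum `Dt` at level `N(E)`, a Heegner datum `H` of discriminant `d_K` and level `N(E)`, an embedding `ι : K → ℂ`, a
point `P ∈ E(K)` mapping to `heegnerPointComplex Dt H`, and `j : K → ℚ₂` with `AssumptionStar E Dt K P j`.  Statement only; TABLE entry; no `_holds` expected.
[cite: KrizLi2019, §6 Table 2 (row 37b1) and Example 6.5 (FMS 7 (2019) e15, chunk p0018 L17; arXiv:1606.03172v3 Congruence.tex ll. 1037, 1044)] -/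
def table2_row37b1 : Prop :=
  ∀ [(⟨0, 1, 1, -23, -50⟩ : WeierstrassCurve ℚ).IsGloballyMinimal]
    (K : Type) [Field K] [NumberField K], IsImaginaryQuadratic K → NumberField.discr K = -7 →
    ∃ (_ : NeZero ((⟨0, 1, 1, -23, -50⟩ : WeierstrassCurve ℚ).conductorNorm ℤ))
      (Dt : ModularParametrizationData (⟨0, 1, 1, -23, -50⟩ : WeierstrassCurve ℚ)
        ((⟨0, 1, 1, -23, -50⟩ : WeierstrassCurve ℚ).conductorNorm ℤ))
      (H : HeegnerDatum ((⟨0, 1, 1, -23, -50⟩ : WeierstrassCurve ℚ).conductorNorm ℤ) (NumberField.discr K))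
      (ι : K →+* ℂ) (P : ((⟨0, 1, 1, -23, -50⟩ : WeierstrassCurve ℚ).baseChange K).toAffine.Point)
      (j : K →ₐ[ℚ] ℚ_[2]),
      Zhai2021.IsOptimalDatum (⟨0, 1, 1, -23, -50⟩ : WeierstrassCurve ℚ) Dt ∧
        WeierstrassCurve.Affine.Point.map ι.toRatAlgHom P = heegnerPointComplex Dt H ∧
          AssumptionStar (⟨0, 1, 1, -23, -50⟩ : WeierstrassCurve ℚ) Dt K P j

/-- **Kriz–Li 2019, §6 Table 2, row `67a1`** (verbatim in the module docstring: `67a1 | d_K = −7 | c₂(E) = 1 | ★ ✓`; Example 6.5): for every imaginary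
quadratic field `K` of discriminant `−7`, the optimal curve `67a1` on its (globally minimal) model `[0,1,1,−12,−21]` (`y² + y = x³ + x² − 12x − 21`) admits
an OPTIMAL modular parametrisation datum `Dt` at level `N(E)`, a Heegner datum `H` of discriminant `d_K` and level `N(E)`, an embedding `ι : K → ℂ`, a
point `P ∈ E(K)` mapping to `heegnerPointComplex Dt H`, and `j : K → ℚ₂` with `AssumptionStar E Dt K P j`.  Statement only; TABLE entry; no `_holds` expected.
[cite: KrizLi2019, §6 Table 2 (row 67a1) and Example 6.5 (FMS 7 (2019) e15, chunk p0018 L17; arXiv:1606.03172v3 Congruence.tex ll. 1037, 1046)] -/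
def table2_row67a1 : Prop :=
  ∀ [(⟨0, 1, 1, -12, -21⟩ : WeierstrassCurve ℚ).IsGloballyMinimal]
    (K : Type) [Field K] [NumberField K], IsImaginaryQuadratic K → NumberField.discr K = -7 →
    ∃ (_ : NeZero ((⟨0, 1, 1, -12, -21⟩ : WeierstrassCurve ℚ).conductorNorm ℤ))
      (Dt : ModularParametrizationData (⟨0, 1, 1, -12, -21⟩ : WeierstrassCurve ℚ)
        ((⟨0, 1, 1, -12, -21⟩ : WeierstrassCurve ℚ).conductorNorm ℤ))
      (H : HeegnerDatum ((⟨0, 1, 1, -12, -21⟩ : WeierstrassCurve ℚ).conductorNorm ℤ) (NumberField.discr K))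
      (ι : K →+* ℂ) (P : ((⟨0, 1, 1, -12, -21⟩ : WeierstrassCurve ℚ).baseChange K).toAffine.Point)
      (j : K →ₐ[ℚ] ℚ_[2]),
      Zhai2021.IsOptimalDatum (⟨0, 1, 1, -12, -21⟩ : WeierstrassCurve ℚ) Dt ∧
        WeierstrassCurve.Affine.Point.map ι.toRatAlgHom P = heegnerPointComplex Dt H ∧
          AssumptionStar (⟨0, 1, 1, -12, -21⟩ : WeierstrassCurve ℚ) Dt K P j

end Literature.NumberTheory.EllipticCurves.KrizLi2019

end
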